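import Mathlib
import HarnessLib
import Literature.Probability.Percolation.Percolation
import Summits.CriticalPhenomena.PercolationContinuityZ3.Theorems.PercNearOneGluingNoHeavyLowerTailAntipodalCutVertexGraph
import Summits.CriticalPhenomena.PercolationContinuityZ3.Theorems.PercNearOneGluingNoHeavyLowerTailVertexCoverSwap

/-!
# THEOREM VC: the fibrewise SPLIT inequality `A ≤ B` when the four terminals form a vertex cover (proof)

Helper file for crux `stmt-CriticalPhenomena-4575` (`NoHeavyLowerTail`, route `PercNearOneGluingNoHeavy`),
new-inequality factory seat `prim-ineq-gen-1` (gen 10); vocabulary (`col`, `IsT`, `BcSat`, `swapSet`, `phi`, `InA`, `InB`)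
in `…VertexCoverSwap.lean`.  Memo: `run/shared/lean/prim/prim-ineq-gen-1/FINDING-16-T2one-and-territory-reduction.md` §7.

`phi_mem_B`: on a vertex-cover multigraph the swap `Φ` (flip the colours of the `b–c` edges and of all edges at satellites
adjacent to both `b` and `c`) maps every `A`-colouring (red `av|bc`, blue `a|v|b|c`) to a `B`-colouring (red `av|b|c`,
blue `a|v|bc`); `card_A_le_card_B_of_vertexCover`: hence `A ≤ B` (T2) for this class — the first T2 theorem with
unboundedly many internally disjoint `S–T` paths (e.g. `K_{4,k}`).  All arguments are "closed vertex set" inductions along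
monochromatic paths, using that every edge at a satellite ends at a terminal.  (This work, 2026-08-20.)
-/

namespace Summit.CriticalPhenomena.PercolationContinuityZ3.Theorems

namespace VertexCoverT2

open Finset Literature.Probability.Percolation AntipodalCutVertex

variable {V : Type*} {ι : Type*} [DecidableEq ι] [Fintype ι]

section Main

variable (e : ι → Sym2 V) (a v b c : V)

/-- **The swap maps `A` into `B`** on vertex-cover graphs. [this work] -/
theorem phi_mem_B (hcover : ∀ i, ∃ t, IsT a v b c t ∧ t ∈ e i) {X : Finset ι} (hX : InA e a v b c X) :
    InB e a v b c (phi e a v b c X) := by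
  obtain ⟨hav, hbc, hnab, hBav, hBab, hBac, hBvb, hBvc, hBbc⟩ := hX
  set R := col e X with hRdef
  set Bl := col e Xᶜ with hBldef
  set R' := col e (phi e a v b c X) with hR'def
  set Bl' := col e (phi e a v b c X)ᶜ with hBl'def
  set S := swapSet e a v b c with hSdef
  have hTa : IsT a v b c a := Or.inl rfl
  have hTv : IsT a v b c v := Or.inr (Or.inl rfl)
  have hTb : IsT a v b c b := Or.inr (Or.inr (Or.inl rfl))
  have hTc : IsT a v b c c := Or.inr (Or.inr (Or.inr rfl))
  -- derived red separations
  have hnac : ¬ (openGraph R).Reachable a c := fun h => hnab (h.trans hbc.symm)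
  have hnvb : ¬ (openGraph R).Reachable v b := fun h => hnab (hav.trans h)
  have hnvc : ¬ (openGraph R).Reachable v c := fun h => hnab (hav.trans (h.trans hbc.symm))
  -- distinctness
  have hab : a ≠ b := fun h => hnab (h ▸ SimpleGraph.Reachable.refl _)
  have hac : a ≠ c := fun h => hnac (h ▸ SimpleGraph.Reachable.refl _)
  have hvb : v ≠ b := fun h => hnvb (h ▸ SimpleGraph.Reachable.refl _)
  have hvc : v ≠ c := fun h => hnvc (h ▸ SimpleGraph.Reachable.refl _)
  have hav' : a ≠ v := fun h => hBav (h ▸ SimpleGraph.Reachable.refl _)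
  have hbc' : b ≠ c := fun h => hBbc (h ▸ SimpleGraph.Reachable.refl _)
  -- edges and colours
  have red_of : ∀ {i : ι} {p q : V}, i ∈ X → e i = s(p, q) → (openGraph R).Reachable p q :=
    fun {i p q} hi he => reachable_of_mem (mem_col.mpr ⟨i, hi, he⟩)
  have blue_of : ∀ {i : ι} {p q : V}, i ∉ X → e i = s(p, q) → (openGraph Bl).Reachable p q :=
    fun {i p q} hi he => reachable_of_mem (mem_col.mpr ⟨i, Finset.mem_compl.mpr hi, he⟩)
  have red'_of : ∀ {i : ι} {p q : V}, i ∈ phi e a v b c X → e i = s(p, q) → (openGraph R').Reachable p q :=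
    fun {i p q} hi he => reachable_of_mem (mem_col.mpr ⟨i, hi, he⟩)
  have blue'_of : ∀ {i : ι} {p q : V}, i ∉ phi e a v b c X → e i = s(p, q) → (openGraph Bl').Reachable p q :=
    fun {i p q} hi he => reachable_of_mem (mem_col.mpr ⟨i, Finset.mem_compl.mpr hi, he⟩)
  -- every edge at a satellite ends at a terminal
  have other_end : ∀ {i : ι} {x : V}, x ∈ e i → ¬ IsT a v b c x → ∃ t, IsT a v b c t ∧ e i = s(x, t) := by
    intro i x hx hxT
    obtain ⟨t, ht, hti⟩ := hcover i
    have hne : x ≠ t := fun h => hxT (h ▸ ht)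
    exact ⟨t, ht, (Sym2.mem_and_mem_iff hne).mp ⟨hx, hti⟩⟩
  -- blue-joined terminals are equal
  have blue_pair : ∀ t t', IsT a v b c t → IsT a v b c t' → (openGraph Bl).Reachable t t' → t = t' := by
    intro t t' ht ht' h
    rcases ht with rfl | rfl | rfl | rfl <;> rcases ht' with rfl | rfl | rfl | rfl
    all_goals first | rfl | exact absurd h hBav | exact absurd h.symm hBav | exact absurd h hBab | exact absurd h.symm hBab | exact absurd h hBac | exact absurd h.symm hBac | exact absurd h hBvb | exact absurd h.symm hBvb | exact absurd h hBvc | exact absurd h.symm hBvc | exact absurd h hBbc | exact absurd h.symm hBbc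
  -- no red join from {a,v} to {b,c}
  have red_ST : ∀ t t', (a = t ∨ v = t) → (b = t' ∨ c = t') → ¬ (openGraph R).Reachable t t' := by
    intro t t' ht ht' h
    rcases ht with rfl | rfl <;> rcases ht' with rfl | rfl
    exacts [hnab h, hnac h, hnvb h, hnvc h]
  have blue_ST : ∀ t t', (a = t ∨ v = t) → (b = t' ∨ c = t') → ¬ (openGraph Bl).Reachable t t' := by
    intro t t' ht ht' h
    rcases ht with rfl | rfl <;> rcases ht' with rfl | rfl
    exacts [hBab h, hBac h, hBvb h, hBvc h]
  -- terminals red-reachable from b are b or c; from a are a or v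
  have T_of_red_S : ∀ s t, (a = s ∨ v = s) → IsT a v b c t → (openGraph R).Reachable s t → a = t ∨ v = t := by
    intro s t hs ht h
    rcases ht with h1 | h1 | h1 | h1
    exacts [Or.inl h1, Or.inr h1, absurd h (red_ST s t hs (Or.inl h1)), absurd h (red_ST s t hs (Or.inr h1))]
  have T_of_red_T : ∀ s t, (b = s ∨ c = s) → IsT a v b c t → (openGraph R).Reachable s t → b = t ∨ c = t := by
    intro s t hs ht h
    rcases ht with h1 | h1 | h1 | h1
    exacts [absurd h.symm (red_ST t s (Or.inl h1) hs), absurd h.symm (red_ST t s (Or.inr h1) hs), Or.inl h1, Or.inr h1]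
  -- no S–T terminal edge; av- and bc-edges are red
  have noST : ∀ (i : ι) t t', (a = t ∨ v = t) → (b = t' ∨ c = t') → e i ≠ s(t, t') := by
    intro i t t' ht ht' he
    by_cases hi : i ∈ X
    exacts [red_ST t t' ht ht' (red_of hi he), blue_ST t t' ht ht' (blue_of hi he)]
  have av_red : ∀ {i : ι}, e i = s(a, v) → i ∈ X := by
    intro i he; by_contra hi; exact hBav (blue_of hi he)
  have bc_red : ∀ {i : ι}, e i = s(b, c) → i ∈ X := by
    intro i he; by_contra hi; exact hBbc (blue_of hi he)
  -- swap-set membership for satellite edges and terminal edges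
  have sat_mem_S : ∀ {i : ι} {x t : V}, ¬ IsT a v b c x → e i = s(x, t) → IsT a v b c t →
      (i ∈ S ↔ BcSat e a v b c x) := by
    intro i x t hxT he ht
    rw [hSdef, mem_swapSet]
    constructor
    · rintro (h | ⟨x', hx', hx'i⟩)
      · rw [he] at h
        rcases Sym2.eq_iff.mp h with ⟨h1, _⟩ | ⟨h1, _⟩
        exacts [(hxT (h1 ▸ hTb)).elim, (hxT (h1 ▸ hTc)).elim]
      · rw [he] at hx'i
        rcases Sym2.mem_iff.mp hx'i with rfl | rfl
        exacts [hx', absurd ht hx'.1]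
    · intro h
      exact Or.inr ⟨x, h, by rw [he]; exact Sym2.mem_mk_left _ _⟩
  have term_not_S : ∀ {i : ι} {t t' : V}, IsT a v b c t → IsT a v b c t' → e i = s(t, t') → e i ≠ s(b, c) →
      i ∉ S := by
    intro i t t' ht ht' he hne h
    rw [hSdef, mem_swapSet] at h
    rcases h with h | ⟨x', hx', hx'i⟩
    · exact hne h
    · rw [he] at hx'i
      rcases Sym2.mem_iff.mp hx'i with rfl | rfl
      exacts [hx'.1 ht, hx'.1 ht']
  -- a satellite's blue edges go to one terminal; its red edges do not join {a,v} to {b,c}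
  have blue_sat : ∀ {x t t' : V} {i j : ι}, ¬ IsT a v b c x → e i = s(x, t) → e j = s(x, t') →
      IsT a v b c t → IsT a v b c t' → i ∉ X → j ∉ X → t = t' := by
    intro x t t' i j _ hei hej ht ht' hi hj
    exact blue_pair t t' ht ht' ((blue_of hi hei).symm.trans (blue_of hj hej))
  have red_sat : ∀ {x t t' : V} {i j : ι}, e i = s(x, t) → e j = s(x, t') →
      (a = t ∨ v = t) → (b = t' ∨ c = t') → i ∈ X → j ∈ X → False := by
    intro x t t' i j hei hej ht ht' hi hj
    exact red_ST t t' ht ht' ((red_of hi hei).symm.trans (red_of hj hej))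
  -- a satellite adjacent to both b and c has no red edge to a or v
  have bcSat_no_red_S : ∀ {x t : V} {i : ι}, BcSat e a v b c x → e i = s(x, t) → (a = t ∨ v = t) → i ∈ X →
      False := by
    intro x t i hbs he ht hi
    obtain ⟨hxT, ⟨jb, hjb⟩, ⟨jc, hjc⟩⟩ := hbs
    by_cases hjbX : jb ∈ X
    · exact red_sat he hjb ht (Or.inl rfl) hi hjbX
    by_cases hjcX : jc ∈ X
    · exact red_sat he hjc ht (Or.inr rfl) hi hjcX
    exact hbc' (blue_sat hxT hjb hjc hTb hTc hjbX hjcX)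
  -- (C1) red' cluster of b: W_b
  have closedT : ∀ (s s' : V), (b = s ∧ c = s' ∨ c = s ∧ b = s') →
      ∀ y, (openGraph R').Reachable s y →
        y ∈ ({y | s = y ∨ (¬ IsT a v b c y ∧ ∀ i t, e i = s(y, t) → IsT a v b c t →
          i ∈ phi e a v b c X → s = t)} : Set V) := by
    intro s s' hss' y hy
    have hsT : IsT a v b c s := by
      rcases hss' with ⟨h, _⟩ | ⟨h, _⟩
      exacts [h ▸ hTb, h ▸ hTc]
    have hsbc : b = s ∨ c = s := by
      rcases hss' with ⟨h, _⟩ | ⟨h, _⟩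
      exacts [Or.inl h, Or.inr h]
    have hedge : s(s, s') = s(b, c) := by
      rcases hss' with ⟨h1, h2⟩ | ⟨h1, h2⟩
      · rw [h1, h2]
      · rw [← h1, ← h2, Sym2.eq_swap]
    -- the other T-terminal: if IsT t and b = t ∨ c = t and t ≠ s then t = s'
    have hother : ∀ t, (b = t ∨ c = t) → s ≠ t → s' = t := by
      intro t ht hst
      rcases hss' with ⟨h1, h2⟩ | ⟨h1, h2⟩ <;> rcases ht with h | h
      exacts [absurd (h1.symm.trans h) hst, h2.symm.trans h, h2.symm.trans h, absurd (h1.symm.trans h) hst]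
    refine mem_of_reachable (Or.inl rfl) ?_ hy
    intro p q hp hpq
    obtain ⟨i, hiΦ, he⟩ := mem_col.mp hpq
    rcases hp with rfl | ⟨hpT, hpW⟩
    · -- p = s (the terminal b or c)
      by_cases hqT : IsT a v b c q
      · by_cases hsq : s = q
        · exact Or.inl hsq
        · exfalso
          -- q ∈ {a,v}: no such edge; q = the other T-terminal: a b–c edge, red in X, hence blue after the swap
          have hbq : (a = q ∨ v = q) ∨ (b = q ∨ c = q) := by
            rcases hqT with h1 | h1 | h1 | h1
            exacts [Or.inl (Or.inl h1), Or.inl (Or.inr h1), Or.inr (Or.inl h1), Or.inr (Or.inr h1)]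
          rcases hbq with hq | hq
          · exact noST i q s hq hsbc (he.trans Sym2.eq_swap)
          · have hebc : e i = s(b, c) := by rw [he, ← hother q hq hsq, hedge]
            exact ((mem_phi_of_mem e a v b c ((mem_swapSet e a v b c).mpr (Or.inl hebc))).mp hiΦ) (bc_red hebc)
      · -- q is a satellite adjacent to s
        refine Or.inr ⟨hqT, ?_⟩
        intro i' t he' ht hi'Φ
        have heq : e i = s(q, s) := he.trans Sym2.eq_swap
        by_cases hbs : BcSat e a v b c q
        · have hiS : i ∈ S := (sat_mem_S hqT heq hsT).mpr hbs
          have hi'S : i' ∈ S := (sat_mem_S hqT he' ht).mpr hbs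
          have hiX : i ∉ X := (mem_phi_of_mem e a v b c hiS).mp hiΦ
          have hi'X : i' ∉ X := (mem_phi_of_mem e a v b c hi'S).mp hi'Φ
          exact blue_sat hqT heq he' hsT ht hiX hi'X
        · have hiS : i ∉ S := fun h => hbs ((sat_mem_S hqT heq hsT).mp h)
          have hi'S : i' ∉ S := fun h => hbs ((sat_mem_S hqT he' ht).mp h)
          have hiX : i ∈ X := (mem_phi_of_not_mem e a v b c hiS).mp hiΦ
          have hi'X : i' ∈ X := (mem_phi_of_not_mem e a v b c hi'S).mp hi'Φ
          have hreach : (openGraph R).Reachable s t := (red_of hiX he).trans (red_of hi'X he')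
          have hbt : b = t ∨ c = t := T_of_red_T s t hsbc ht hreach
          by_contra hst
          have hs't : s' = t := hother t hbt hst
          -- then q is adjacent to both b and c: BcSat q, contradiction
          apply hbs
          refine ⟨hqT, ?_, ?_⟩
          · rcases hss' with ⟨h1, _⟩ | ⟨_, h2⟩
            · exact ⟨i, by rw [heq, h1]⟩
            · exact ⟨i', by rw [he', ← hs't, h2]⟩
          · rcases hss' with ⟨_, h2⟩ | ⟨h1, _⟩
            · exact ⟨i', by rw [he', ← hs't, h2]⟩
            · exact ⟨i, by rw [heq, h1]⟩
    · -- p is a satellite in W: its red' edges all go to s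
      obtain ⟨t, ht, het⟩ := other_end (by rw [he]; exact Sym2.mem_mk_left _ _) hpT
      have hqt : q = t := snd_eq_of_eq (he.symm.trans het)
      exact Or.inl ((hpW i t het ht hiΦ).trans hqt.symm)
  have hR'ba : ¬ (openGraph R').Reachable b a := by
    intro h
    rcases closedT b c (Or.inl ⟨rfl, rfl⟩) a h with h1 | ⟨h2, _⟩
    exacts [hab h1.symm, h2 hTa]
  have hR'bc : ¬ (openGraph R').Reachable b c := by
    intro h
    rcases closedT b c (Or.inl ⟨rfl, rfl⟩) c h with h1 | ⟨h2, _⟩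
    exacts [hbc' h1, h2 hTc]
  have hR'ca : ¬ (openGraph R').Reachable c a := by
    intro h
    rcases closedT c b (Or.inr ⟨rfl, rfl⟩) a h with h1 | ⟨h2, _⟩
    exacts [hac h1.symm, h2 hTa]
  -- (C3) the red a–v path survives
  have hR'av : (openGraph R').Reachable a v := by
    have hmem := mem_of_reachable (W := {y | (openGraph R').Reachable a y ∧ (openGraph R).Reachable a y})
      (s := a) (ω := R) ⟨SimpleGraph.Reachable.refl _, SimpleGraph.Reachable.refl _⟩ ?_ hav
    · exact hmem.1
    intro p q hp hpq
    obtain ⟨i, hiX, he⟩ := mem_col.mp hpq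
    have haq : (openGraph R).Reachable a q := hp.2.trans (red_of hiX he)
    have hiS : i ∉ S := by
      intro hiS
      rcases (mem_swapSet e a v b c).mp hiS with hbc_eq | ⟨x, hbs, hxi⟩
      · -- a b–c edge on a red path from a: then p ∈ {b,c}
        rw [he] at hbc_eq
        rcases Sym2.eq_iff.mp hbc_eq with ⟨h1, _⟩ | ⟨h1, _⟩
        · exact hnab (h1 ▸ hp.2)
        · exact hnac (h1 ▸ hp.2)
      · rw [he] at hxi
        rcases Sym2.mem_iff.mp hxi with rfl | rfl
        · -- x = p is a bc-satellite, red-reachable from a, with a red edge to the terminal q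
          obtain ⟨t, ht, het⟩ := other_end (by rw [he]; exact Sym2.mem_mk_left _ _) hbs.1
          have hqt : q = t := snd_eq_of_eq (he.symm.trans het)
          have haT : a = t ∨ v = t := T_of_red_S a t (Or.inl rfl) ht (hqt ▸ haq)
          exact bcSat_no_red_S hbs het haT hiX
        · -- x = q is a bc-satellite; then p is a terminal red-reachable from a
          obtain ⟨t, ht, het⟩ := other_end (by rw [he]; exact Sym2.mem_mk_right _ _) hbs.1
          have hpt : p = t := snd_eq_of_eq ((he.trans Sym2.eq_swap).symm.trans het)
          have haT : a = t ∨ v = t := T_of_red_S a t (Or.inl rfl) ht (hpt ▸ hp.2)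
          exact bcSat_no_red_S hbs het haT hiX
    have hiΦ : i ∈ phi e a v b c X := (mem_phi_of_not_mem e a v b c hiS).mpr hiX
    exact ⟨hp.1.trans (red'_of hiΦ he), haq⟩
  -- (C4) b ~ c becomes blue
  have hBl'bc : (openGraph Bl').Reachable b c := by
    -- find the atom carrying the red b–c join
    have atom : (∃ i ∈ X, e i = s(b, c)) ∨
        ∃ x i j, ¬ IsT a v b c x ∧ i ∈ X ∧ j ∈ X ∧ e i = s(x, b) ∧ e j = s(x, c) := by
      by_contra hno
      obtain ⟨hno1, hno2⟩ := not_or.mp hno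
      have hmem := mem_of_reachable
        (W := {y | b = y ∨ (¬ IsT a v b c y ∧ ∃ i ∈ X, e i = s(y, b))}) (s := b) (ω := R) (Or.inl rfl) ?_ hbc
      · rcases hmem with h1 | ⟨h2, _⟩
        exacts [hbc' h1, h2 hTc]
      intro p q hp hpq
      obtain ⟨i, hiX, he⟩ := mem_col.mp hpq
      rcases hp with rfl | ⟨hpT, j, hjX, hej⟩
      · by_cases hqT : IsT a v b c q
        · rcases hqT with h1 | h1 | h1 | h1
          · exact absurd (he.trans Sym2.eq_swap) (noST i q b (Or.inl h1) (Or.inl rfl))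
          · exact absurd (he.trans Sym2.eq_swap) (noST i q b (Or.inr h1) (Or.inl rfl))
          · exact Or.inl h1
          · exact (hno1 ⟨i, hiX, by rw [he, h1]⟩).elim
        · exact Or.inr ⟨hqT, i, hiX, he.trans Sym2.eq_swap⟩
      · obtain ⟨t, ht, het⟩ := other_end (by rw [he]; exact Sym2.mem_mk_left _ _) hpT
        have hqt : q = t := snd_eq_of_eq (he.symm.trans het)
        rcases ht with h1 | h1 | h1 | h1
        · exact (red_sat het hej (Or.inl h1) (Or.inl rfl) hiX hjX).elim
        · exact (red_sat het hej (Or.inr h1) (Or.inl rfl) hiX hjX).elim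
        · exact Or.inl (h1.trans hqt.symm)
        · exact (hno2 ⟨p, j, i, hpT, hjX, hiX, hej, by rw [het, h1]⟩).elim
    rcases atom with ⟨i, hiX, he⟩ | ⟨x, i, j, hxT, hiX, hjX, hei, hej⟩
    · have hiS : i ∈ S := (mem_swapSet e a v b c).mpr (Or.inl he)
      have hiΦ : i ∉ phi e a v b c X := fun h => (mem_phi_of_mem e a v b c hiS).mp h hiX
      exact blue'_of hiΦ he
    · have hbs : BcSat e a v b c x := ⟨hxT, ⟨i, hei⟩, ⟨j, hej⟩⟩
      have hiS : i ∈ S := (sat_mem_S hxT hei hTb).mpr hbs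
      have hjS : j ∈ S := (sat_mem_S hxT hej hTc).mpr hbs
      have hiΦ : i ∉ phi e a v b c X := fun h => (mem_phi_of_mem e a v b c hiS).mp h hiX
      have hjΦ : j ∉ phi e a v b c X := fun h => (mem_phi_of_mem e a v b c hjS).mp h hjX
      exact (blue'_of hiΦ hei).symm.trans (blue'_of hjΦ hej)
  -- (C5/C6) blue' clusters of a and of v
  have closedS : ∀ (s s' : V), (a = s ∧ v = s' ∨ v = s ∧ a = s') →
      ∀ y, (openGraph Bl').Reachable s y →
        y ∈ ({y | s = y ∨ (¬ IsT a v b c y ∧ ¬ BcSat e a v b c y ∧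
          ∀ i t, e i = s(y, t) → IsT a v b c t → i ∉ X → s = t)} : Set V) := by
    intro s s' hss' y hy
    have hsT : IsT a v b c s := by
      rcases hss' with ⟨h, _⟩ | ⟨h, _⟩
      exacts [h ▸ hTa, h ▸ hTv]
    have hsav : a = s ∨ v = s := by
      rcases hss' with ⟨h, _⟩ | ⟨h, _⟩
      exacts [Or.inl h, Or.inr h]
    have hedge : s(s, s') = s(a, v) := by
      rcases hss' with ⟨h1, h2⟩ | ⟨h1, h2⟩
      · rw [h1, h2]
      · rw [← h1, ← h2, Sym2.eq_swap]
    have hother : ∀ t, (a = t ∨ v = t) → s ≠ t → s' = t := by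
      intro t ht hst
      rcases hss' with ⟨h1, h2⟩ | ⟨h1, h2⟩ <;> rcases ht with h | h
      exacts [absurd (h1.symm.trans h) hst, h2.symm.trans h, h2.symm.trans h, absurd (h1.symm.trans h) hst]
    refine mem_of_reachable (Or.inl rfl) ?_ hy
    intro p q hp hpq
    obtain ⟨i, hiΦc, he⟩ := mem_col.mp hpq
    have hiΦ : i ∉ phi e a v b c X := Finset.mem_compl.mp hiΦc
    rcases hp with rfl | ⟨hpT, hpbs, hpW⟩
    · by_cases hqT : IsT a v b c q
      · by_cases hsq : s = q
        · exact Or.inl hsq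
        · exfalso
          -- q = the other S-terminal: an a–v edge, red in X and not swapped; q ∈ {b,c}: no such edge
          have hbq : (a = q ∨ v = q) ∨ (b = q ∨ c = q) := by
            rcases hqT with h1 | h1 | h1 | h1
            exacts [Or.inl (Or.inl h1), Or.inl (Or.inr h1), Or.inr (Or.inl h1), Or.inr (Or.inr h1)]
          rcases hbq with hq | hq
          · have heav : e i = s(a, v) := by rw [he, ← hother q hq hsq, hedge]
            have hiS : i ∉ S := term_not_S hTa hTv heav (by
              rw [heav]; intro h
              rcases Sym2.eq_iff.mp h with ⟨h2, _⟩ | ⟨h2, _⟩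
              exacts [hab h2, hac h2])
            exact hiΦ ((mem_phi_of_not_mem e a v b c hiS).mpr (av_red heav))
          · exact noST i s q hsav hq he
      · -- q is a satellite joined to s by an edge that is blue after the swap
        have heq : e i = s(q, s) := he.trans Sym2.eq_swap
        by_cases hbs : BcSat e a v b c q
        · exfalso
          have hiS : i ∈ S := (sat_mem_S hqT heq hsT).mpr hbs
          have hiX : i ∈ X := by
            by_contra h
            exact hiΦ ((mem_phi_of_mem e a v b c hiS).mpr h)
          exact bcSat_no_red_S hbs heq hsav hiX
        · have hiS : i ∉ S := fun h => hbs ((sat_mem_S hqT heq hsT).mp h)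
          have hiX : i ∉ X := fun h => hiΦ ((mem_phi_of_not_mem e a v b c hiS).mpr h)
          refine Or.inr ⟨hqT, hbs, ?_⟩
          intro i' t he' ht hi'X
          exact blue_sat hqT heq he' hsT ht hiX hi'X
    · -- p is an unswapped satellite in W: its blue edges all go to s
      obtain ⟨t, ht, het⟩ := other_end (by rw [he]; exact Sym2.mem_mk_left _ _) hpT
      have hqt : q = t := snd_eq_of_eq (he.symm.trans het)
      have hiS : i ∉ S := fun h => hpbs ((sat_mem_S hpT het ht).mp h)
      have hiX : i ∉ X := fun h => hiΦ ((mem_phi_of_not_mem e a v b c hiS).mpr h)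
      exact Or.inl ((hpW i t het ht hiX).trans hqt.symm)
  have hBl'av : ¬ (openGraph Bl').Reachable a v := by
    intro h
    rcases closedS a v (Or.inl ⟨rfl, rfl⟩) v h with h1 | ⟨h2, _⟩
    exacts [hav' h1, h2 hTv]
  have hBl'ab : ¬ (openGraph Bl').Reachable a b := by
    intro h
    rcases closedS a v (Or.inl ⟨rfl, rfl⟩) b h with h1 | ⟨h2, _⟩
    exacts [hab h1, h2 hTb]
  have hBl'vb : ¬ (openGraph Bl').Reachable v b := by
    intro h
    rcases closedS v a (Or.inr ⟨rfl, rfl⟩) b h with h1 | ⟨h2, _⟩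
    exacts [hvb h1, h2 hTb]
  exact ⟨hR'av, fun h => hR'ba h.symm, fun h => hR'ca h.symm, hR'bc, hBl'bc, hBl'av, hBl'ab, hBl'vb⟩

open scoped Classical in
/-- **THEOREM VC** (FINDING-16 §7): for every multigraph (free edges `e : ι → Sym2 V`) whose terminals `a, v, b, c`
form a vertex cover (every edge has a terminal endpoint), the fibrewise SPLIT inequality holds:
`#{X : red = av|bc, blue = a|v|b|c} ≤ #{X : red = av|b|c, blue = a|v|bc}` (red `= e(X)`, blue `= e(Xᶜ)`).
The swap `Φ` of the colours on the `b–c` edges and at the satellites adjacent to both `b` and `c` is an injection from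
the left set into the right set. [new] -/
theorem card_A_le_card_B_of_vertexCover (hcover : ∀ i, ∃ t, IsT a v b c t ∧ t ∈ e i) :
    (Finset.univ.filter (fun X : Finset ι => InA e a v b c X)).card ≤
      (Finset.univ.filter (fun X : Finset ι => InB e a v b c X)).card := by
  refine Finset.card_le_card_of_injOn (phi e a v b c) ?_ ?_
  · intro X hX
    rw [Finset.mem_coe, Finset.mem_filter] at hX ⊢
    exact ⟨Finset.mem_univ _, phi_mem_B e a v b c hcover hX.2⟩
  · intro X _ X' _ h
    have := congrArg (phi e a v b c) h
    rwa [phi_phi, phi_phi] at this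

end Main

end VertexCoverT2

end Summit.CriticalPhenomena.PercolationContinuityZ3.Theorems
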